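/-
Copyright (c) 2026 the pub-hodgecm-mathlib formalisation cell (harness21).  Prover seat hodgecm-mathlib-A-p14 (g32), P6 «MOD programme»,
board offer (ν2) of A-p17 (g26)՚s FINDING «G1c base is not Dedekind», group-law half; 2026-09-01.
-/
import Literature.AlgebraicGeometry.Limits.SeparatedSchematicExt
import Mathlib.CategoryTheory.Monoidal.Cartesian.Over
import Mathlib.CategoryTheory.Monoidal.Cartesian.Grp
import HarnessLib

/-!
# Base change along a quasi-compact scheme-theoretically dominant morphism REFLECTS HOMOMORPHISMS of group schemes
# (EGA IV₃ 11.10.5; Artin, *Néron models* (1.1))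

Topic `AlgebraicGeometry/Limits`, namespace `Literature.AlgebraicGeometry.Limits`.  THEOREMS ONLY (no definition, no named fact, no `instance`, no notation, no
`sorry`).  Cell `hodgecm-mathlib` (D-0151), F0/P6 «MOD», board offer **(ν2) «HOMS OVER `Ω` DESCEND TO A FINITE STAGE»**, group-law half: once an
`Ω`-HOMOMORPHISM has been spread to a morphism `F` over a finite field stage `L′ ⊆ Ω` (★ `AbelianSchemeMorphismSpreadFiniteStage`, EGA IV₃ 8.8.2), `F` is again a
HOMOMORPHISM because base change along `Spec Ω → Spec L′` (faithfully flat, quasi-compact, hence scheme-theoretically dominant) reflects the two homomorphism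
identities.  Generalises ★ `AbelianSchemes.isMonHom_of_isMonHom_genericFibre` (`i = Spec K → Spec R`, the generic point) VERBATIM to any quasi-compact
scheme-theoretically dominant `i : T′ → T`, over ★ `pullback_map_injective_of_flat` (`Limits/SeparatedSchematicExt`); `--supports stmt-HodgeConjecture-24832`,
COUNT-NEUTRAL.  HONEST LABEL: HC_CM is proved only modulo the 2 remaining named inputs (hLiu418 24832, h413 24833) until rung 0 closes; this file discharges none.

## Mathematics

`i : T′ → T` quasi-compact and scheme-theoretically dominant; `𝒜 → T` a FLAT and `ℬ → T` a SEPARATED `T`-group scheme (group objects of the cartesian-monoidal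
`Over T`); `f : 𝒜 → ℬ` a `T`-morphism whose base change `f ×_T T′` is a homomorphism for the transported group structures (Mathlib: `Over.pullback i` is
cartesian-monoidal, `Functor.obj.η_def ∕ μ_def`).  Then `η ≫ f = η` and `μ ≫ f = (f ⊗ f) ≫ μ` hold after base change (cancel the invertible coherence maps), and
base change is INJECTIVE on `Hom_T(X, ℬ)` for `X ∈ {𝟙, 𝒜 ⊗ 𝒜}` flat over `T` (★ `pullback_map_injective_of_flat`: `X ×_T T′ → X` is scheme-theoretically dominant,
[EGAIV3] 11.10.5, and `ℬ` is separated), so **`f` is a homomorphism**.  [Artin1986NeronModels] §1 (1.1) (uniqueness of extensions); [GortzWedhorn2020] Prop. 9.19.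

## Contents

* `flat_tensorUnit_hom`, `flat_tensorObj_hom` (flatness of `𝟙 → T`, `𝒜 ×_T ℬ → T`), **`isMonHom_of_isMonHom_pullback_map`**.

## References
* [EGAIV3] A. Grothendieck, J. Dieudonné, EGA IV₃ (Publ. Math. IHÉS 28, 1966), 11.10.5, 11.10.1.
* [Artin1986NeronModels] M. Artin, *Néron models*, in: Arithmetic Geometry (Cornell–Silverman eds., 1986), §1 (1.1) (p. 214).
* [GortzWedhorn2020] U. Görtz, T. Wedhorn, *Algebraic Geometry I*, 2nd ed. (2020), Prop. 9.19, Lemma 14.6.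
-/

set_option autoImplicit false

noncomputable section

universe u

open CategoryTheory CategoryTheory.Limits AlgebraicGeometry MonoidalCategory CartesianMonoidalCategory
open scoped MonObj Obj

namespace Literature.AlgebraicGeometry.Limits

variable {T' T : Scheme.{u}} (i : T' ⟶ T)

/-- `T → T` (the monoidal unit of `Over T`) is flat. [cite: GortzWedhorn2020, Prop. 9.19] -/
theorem flat_tensorUnit_hom : Flat (𝟙_ (Over T)).hom := by
  rw [Over.tensorUnit_hom]
  exact MorphismProperty.id_mem _ _

/-- `𝒜 ×_T ℬ → T` is flat for flat `𝒜`, `ℬ`. [cite: GortzWedhorn2020, Lemma 14.6] -/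
theorem flat_tensorObj_hom (𝒜 ℬ : Over T) [Flat 𝒜.hom] [Flat ℬ.hom] : Flat (𝒜 ⊗ ℬ).hom := by
  rw [Over.tensorObj_hom]
  exact MorphismProperty.comp_mem _ _ _ (MorphismProperty.pullback_fst _ _ ‹_›) ‹_›

/-- **Base change along a quasi-compact scheme-theoretically dominant `i : T′ → T` REFLECTS HOMOMORPHISMS**: for a flat `T`-group scheme `𝒜`, a separated
`T`-group scheme `ℬ` and a `T`-morphism `f : 𝒜 → ℬ`, if `f ×_T T′` is a homomorphism (group structures transported along the cartesian-monoidal `Over.pullback i`)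
then so is `f`. [cite: EGAIV3, 11.10.5 and 11.10.1] [cite: Artin1986NeronModels, §1 (1.1) (p. 214)] -/
theorem isMonHom_of_isMonHom_pullback_map [QuasiCompact i] [IsSchemeTheoreticallyDominant i] (𝒜 ℬ : Over T) [GrpObj 𝒜] [GrpObj ℬ]
    [Flat 𝒜.hom] [IsSeparated ℬ.hom] (f : 𝒜 ⟶ ℬ) [hf : IsMonHom ((Over.pullback i).map f)] : IsMonHom f where
  one_hom := by
    haveI := flat_tensorUnit_hom (T := T)
    apply pullback_map_injective_of_flat i (X := 𝟙_ (Over T)) (N := ℬ)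
    have h := hf.one_hom
    simp only [Functor.obj.η_def, Category.assoc] at h
    rw [cancel_epi] at h
    change (Over.pullback i).map (η[𝒜] ≫ f) = (Over.pullback i).map η[ℬ]
    rw [CategoryTheory.Functor.map_comp]
    exact h
  mul_hom := by
    haveI : Flat (𝒜 ⊗ 𝒜).hom := flat_tensorObj_hom 𝒜 𝒜
    apply pullback_map_injective_of_flat i (X := 𝒜 ⊗ 𝒜) (N := ℬ)
    have h := hf.mul_hom
    simp only [Functor.obj.μ_def, Category.assoc] at h
    rw [Functor.LaxMonoidal.μ_natural_assoc, cancel_epi] at h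
    change (Over.pullback i).map (μ[𝒜] ≫ f) = (Over.pullback i).map ((f ⊗ₘ f) ≫ μ[ℬ])
    rw [CategoryTheory.Functor.map_comp, CategoryTheory.Functor.map_comp]
    exact h

end Literature.AlgebraicGeometry.Limits

/-! ## ED. 2 — the field-extension instance: `Spec Ω → Spec L` reflects homomorphisms (turnkey form for (ν2)) -/

namespace Literature.AlgebraicGeometry.Limits

/-- `Spec` of a field homomorphism is SURJECTIVE (both spectra are single points). [cite: GortzWedhorn2020, Prop. 9.19] -/
theorem surjective_specMap_of_field {L Ω : Type u} [Field L] [Field Ω] (j : L →+* Ω) : Surjective (Spec.map (CommRingCat.ofHom j)) :=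
  ⟨fun _ => ⟨default, Subsingleton.elim _ _⟩⟩

/-- `Spec` of a field homomorphism is SCHEME-THEORETICALLY DOMINANT (surjective onto the reduced `Spec L`). [cite: EGAIV3, 11.10.5 and 11.10.1] -/
theorem isSchemeTheoreticallyDominant_specMap_of_field {L Ω : Type u} [Field L] [Field Ω] (j : L →+* Ω) :
    IsSchemeTheoreticallyDominant (Spec.map (CommRingCat.ofHom j)) := by
  haveI := surjective_specMap_of_field j
  exact IsSchemeTheoreticallyDominant.of_isDominant _

/-- **TURNKEY FORM over a field**: for a field extension `j : L → Ω`, `L`-group schemes `𝒜` (ANY — everything is flat over a field) and `ℬ` (separated), an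
`L`-morphism `f : 𝒜 → ℬ` whose base change to `Ω` is a homomorphism is a homomorphism — the group-law half of (ν2) «an `Ω`-homomorphism spread to a finite
field stage `L′ ⊆ Ω` is a homomorphism». [cite: EGAIV3, 11.10.5 and 11.10.1] [cite: Artin1986NeronModels, §1 (1.1) (p. 214)] -/
theorem isMonHom_of_isMonHom_pullback_specMap_of_field {L Ω : Type u} [Field L] [Field Ω] (j : L →+* Ω)
    (𝒜 ℬ : Over (Spec (CommRingCat.of L))) [GrpObj 𝒜] [GrpObj ℬ] [IsSeparated ℬ.hom] (f : 𝒜 ⟶ ℬ)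
    [hf : IsMonHom ((Over.pullback (Spec.map (CommRingCat.ofHom j))).map f)] : IsMonHom f := by
  haveI := isSchemeTheoreticallyDominant_specMap_of_field j
  haveI : Flat 𝒜.hom := inferInstance
  exact isMonHom_of_isMonHom_pullback_map (Spec.map (CommRingCat.ofHom j)) 𝒜 ℬ f

end Literature.AlgebraicGeometry.Limits
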